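import Mathlib
import Summits.QuantumFields.QCD.Theorems.QuarksAsStableActionUnquenchedChessboardBoundLinkGramForm
import Summits.QuantumFields.QCD.Theorems.QuarksAsStableActionUnquenchedChessboardBoundLinkGramCouplings
import HarnessLib

/-!
# Link Gram identity, part 9a: the form is a bounded Hermitian sesquilinear RP form
(crux stmt-QuantumFields-9735, line `Sketch`, lead's stub `linkGram`)

`linkForm β Φ Ψ = ∫ Ψ(U) conj Φ(ΘU) linkKer β U dU` on the admissible class (measurable, bounded,
depending on positive-time links): `measurable_linkKer`, `norm_linkKer_le`, `conj_linkKer_timeReflect`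
(`conj K(ΘU) = K(U)`), `linkForm_conj_symm` (Hermitian, by the measure-preserving involution `Θ`),
`linkForm_add_smul` (sesquilinear expansion), `linkAdm_add_smul` (the class is closed under
`F + t•G`). All statements are proved.
-/

noncomputable section

open MeasureTheory Matrix Complex Finset
open Literature.MathematicalPhysics.QuantumFieldTheory Literature.MathematicalPhysics.QuantumLattice
open Literature.Probability.LatticeModels (TorusSite)
open scoped ComplexConjugate BigOperators ComplexOrder

namespace Summit.QuantumFields.QCD.Theorems.UnquenchedChessboardBoundLine

variable {L N : ℕ} [NeZero L]

/-! ## The kernel: measurability, bound, reflection -/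

/-- The kernel is measurable. -/
theorem measurable_linkKer (β : ℝ) : Measurable (linkKer (L := L) (N := N) β) := by
  have hρ : Continuous (fundamentalRep (Fin N)) := continuous_fundamentalRep (Fin N)
  have hg := (WilsonRP.measurable_gObs (fundamentalRep (Fin N)) hρ β
    (measurable_const (a := (1 : ℂ)))).comp (measurable_linkZ (L := L) (N := N))
  have hgΘ := hg.comp WilsonRP.measurable_timeReflect
  have hconj : Measurable (starRingEnd ℂ : ℂ → ℂ) := Complex.continuous_conj.measurable
  unfold linkKer
  refine (hg.mul (hconj.comp hgΘ)).mul (Complex.measurable_exp.comp (Finset.measurable_sum _ fun i _ => ?_))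
  exact ((WilsonRP.measurable_coeff _ hρ β i).comp measurable_linkZ).mul
    (hconj.comp (((WilsonRP.measurable_coeff _ hρ β i).comp measurable_linkZ).comp
      WilsonRP.measurable_timeReflect))

/-- The kernel is bounded (for `β ≥ 0`). -/
theorem norm_linkKer_le {β : ℝ} (hβ : 0 ≤ β) (U : GaugeConfig 4 L (Matrix.specialUnitaryGroup (Fin N) ℂ)) :
    ‖linkKer β U‖ ≤
      (|(1 : ℝ)| * Real.exp (β * (N * Fintype.card (Plaquette 4 L)))) *
        (|(1 : ℝ)| * Real.exp (β * (N * Fintype.card (Plaquette 4 L)))) *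
        Real.exp (Fintype.card (WilsonRP.CoeffIndex 4 L N) * (Real.sqrt (β / 2) * Real.sqrt (β / 2))) := by
  have hρ : Continuous (fundamentalRep (Fin N)) := continuous_fundamentalRep (Fin N)
  unfold linkKer
  rw [norm_mul, norm_mul, Complex.norm_conj]
  refine mul_le_mul (mul_le_mul (WilsonRP.norm_gObs_le _ hρ hβ (fun _ => by simp) _)
    (WilsonRP.norm_gObs_le _ hρ hβ (fun _ => by simp) _) (norm_nonneg _) (by positivity)) ?_
    (norm_nonneg _) (by positivity)
  rw [Complex.norm_exp]
  refine Real.exp_le_exp.2 ((Complex.re_le_norm _).trans ?_)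
  calc ‖∑ i : WilsonRP.CoeffIndex 4 L N, WilsonRP.coeff (fundamentalRep (Fin N)) hρ β i (linkZ U) *
          conj (WilsonRP.coeff (fundamentalRep (Fin N)) hρ β i (linkZ (GaugeConfig.timeReflect U)))‖
      ≤ ∑ i : WilsonRP.CoeffIndex 4 L N, ‖WilsonRP.coeff (fundamentalRep (Fin N)) hρ β i (linkZ U) *
          conj (WilsonRP.coeff (fundamentalRep (Fin N)) hρ β i (linkZ (GaugeConfig.timeReflect U)))‖ :=
        norm_sum_le _ _
    _ ≤ ∑ _i : WilsonRP.CoeffIndex 4 L N, Real.sqrt (β / 2) * Real.sqrt (β / 2) :=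
        Finset.sum_le_sum fun i _ => by
          rw [norm_mul, Complex.norm_conj]
          exact mul_le_mul (WilsonRP.norm_coeff_le _ hρ β i _) (WilsonRP.norm_coeff_le _ hρ β i _)
            (norm_nonneg _) (Real.sqrt_nonneg _)
    _ = Fintype.card (WilsonRP.CoeffIndex 4 L N) * (Real.sqrt (β / 2) * Real.sqrt (β / 2)) := by
        rw [Finset.sum_const, Finset.card_univ, nsmul_eq_mul]

/-- **The kernel is reflection-Hermitian**: `conj K(ΘU) = K(U)` (`L` even). -/
theorem conj_linkKer_timeReflect (hL : Even L) (β : ℝ)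
    (U : GaugeConfig 4 L (Matrix.specialUnitaryGroup (Fin N) ℂ)) :
    conj (linkKer β (GaugeConfig.timeReflect U)) = linkKer β U := by
  have _ := hL
  unfold linkKer
  rw [timeReflect_involutive_cfg U]
  simp only [map_mul, Complex.conj_conj, ← Complex.exp_conj, map_sum]
  have hs : (∑ i : WilsonRP.CoeffIndex 4 L N,
      conj (WilsonRP.coeff (fundamentalRep (Fin N)) (continuous_fundamentalRep (Fin N)) β i
        (linkZ (GaugeConfig.timeReflect U))) *
        WilsonRP.coeff (fundamentalRep (Fin N)) (continuous_fundamentalRep (Fin N)) β i (linkZ U)) =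
      ∑ i : WilsonRP.CoeffIndex 4 L N,
        WilsonRP.coeff (fundamentalRep (Fin N)) (continuous_fundamentalRep (Fin N)) β i (linkZ U) *
          conj (WilsonRP.coeff (fundamentalRep (Fin N)) (continuous_fundamentalRep (Fin N)) β i
            (linkZ (GaugeConfig.timeReflect U))) :=
    Finset.sum_congr rfl fun i _ => mul_comm _ _
  rw [hs]
  ring

/-! ## The admissible class and the integrands -/

/-- The integrand of the form is measurable. -/
theorem measurable_linkForm_integrand (β : ℝ)
    {Φ Ψ : GaugeConfig 4 L (Matrix.specialUnitaryGroup (Fin N) ℂ) → ℂ} (hΦ : Measurable Φ) (hΨ : Measurable Ψ) :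
    Measurable fun U => Ψ U * conj (Φ (GaugeConfig.timeReflect U)) * linkKer β U :=
  (hΨ.mul (Complex.continuous_conj.measurable.comp (hΦ.comp WilsonRP.measurable_timeReflect))).mul
    (measurable_linkKer β)

/-- The integrand of the form is integrable (bounded measurable on a probability space). -/
theorem integrable_linkForm_integrand {β : ℝ} (hβ : 0 ≤ β)
    {Φ Ψ : GaugeConfig 4 L (Matrix.specialUnitaryGroup (Fin N) ℂ) → ℂ} (hΦ : Measurable Φ) (hΨ : Measurable Ψ)
    {KΦ KΨ : ℝ} (hKΦ : ∀ U, ‖Φ U‖ ≤ KΦ) (hKΨ : ∀ U, ‖Ψ U‖ ≤ KΨ) :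
    Integrable (fun U => Ψ U * conj (Φ (GaugeConfig.timeReflect U)) * linkKer β U)
      (Measure.pi fun _ : Edge 4 L => haarProbability (Matrix.specialUnitaryGroup (Fin N) ℂ)) := by
  refine Integrable.of_bound (measurable_linkForm_integrand β hΦ hΨ).aestronglyMeasurable
    (KΨ * KΦ * ((|(1 : ℝ)| * Real.exp (β * (N * Fintype.card (Plaquette 4 L)))) *
        (|(1 : ℝ)| * Real.exp (β * (N * Fintype.card (Plaquette 4 L)))) *
        Real.exp (Fintype.card (WilsonRP.CoeffIndex 4 L N) * (Real.sqrt (β / 2) * Real.sqrt (β / 2)))))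
    (Filter.Eventually.of_forall fun U => ?_)
  rw [norm_mul, norm_mul, Complex.norm_conj]
  have h0 : 0 ≤ KΦ := (norm_nonneg _).trans (hKΦ U)
  exact mul_le_mul (mul_le_mul (hKΨ U) (hKΦ _) (norm_nonneg _) ((norm_nonneg _).trans (hKΨ U)))
    (norm_linkKer_le hβ U) (norm_nonneg _) (mul_nonneg ((norm_nonneg _).trans (hKΨ U)) h0)

/-- **Hermitian symmetry**: `B(Ψ, Φ) = conj B(Φ, Ψ)` (`Θ` is a measure-preserving involution and
`conj K ∘ Θ = K`). -/
theorem linkForm_conj_symm (hL : Even L) (β : ℝ)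
    {Φ Ψ : GaugeConfig 4 L (Matrix.specialUnitaryGroup (Fin N) ℂ) → ℂ} (hΦ : Measurable Φ) (hΨ : Measurable Ψ) :
    linkForm β Ψ Φ = conj (linkForm β Φ Ψ) := by
  unfold linkForm
  rw [← integral_conj]
  have hmeas : Measurable fun U : GaugeConfig 4 L (Matrix.specialUnitaryGroup (Fin N) ℂ) =>
      (starRingEnd ℂ) (Ψ U * (starRingEnd ℂ) (Φ (GaugeConfig.timeReflect U)) * linkKer β U) :=
    Complex.continuous_conj.measurable.comp (measurable_linkForm_integrand β hΦ hΨ)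
  rw [← LatticeRP.integral_comp_eq_of_measurePreserving WilsonRP.measurePreserving_timeReflect hmeas]
  refine integral_congr_ae (ae_of_all _ fun U => ?_)
  simp only [map_mul, Complex.conj_conj, timeReflect_involutive_cfg U, conj_linkKer_timeReflect hL]
  ring

/-- **Sesquilinear expansion** of the form on `F + t • G`. -/
theorem linkForm_add_smul {β : ℝ} (hβ : 0 ≤ β)
    {F G : GaugeConfig 4 L (Matrix.specialUnitaryGroup (Fin N) ℂ) → ℂ} (t : ℂ) (hF : Measurable F) (hG : Measurable G)
    {KF KG : ℝ} (hKF : ∀ U, ‖F U‖ ≤ KF) (hKG : ∀ U, ‖G U‖ ≤ KG) :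
    linkForm β (F + t • G) (F + t • G) =
      linkForm β F F + conj t * linkForm β G F + t * linkForm β F G + conj t * t * linkForm β G G := by
  unfold linkForm
  have iFF := integrable_linkForm_integrand hβ hF hF hKF hKF
  have iGF := integrable_linkForm_integrand hβ hG hF hKG hKF
  have iFG := integrable_linkForm_integrand hβ hF hG hKF hKG
  have iGG := integrable_linkForm_integrand hβ hG hG hKG hKG
  have hpt : (fun U : GaugeConfig 4 L (Matrix.specialUnitaryGroup (Fin N) ℂ) =>
      (F + t • G) U * conj ((F + t • G) (GaugeConfig.timeReflect U)) * linkKer β U) =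
      fun U => F U * conj (F (GaugeConfig.timeReflect U)) * linkKer β U +
        conj t * (F U * conj (G (GaugeConfig.timeReflect U)) * linkKer β U) +
        t * (G U * conj (F (GaugeConfig.timeReflect U)) * linkKer β U) +
        conj t * t * (G U * conj (G (GaugeConfig.timeReflect U)) * linkKer β U) := by
    funext U
    simp only [Pi.add_apply, Pi.smul_apply, smul_eq_mul, map_add, map_mul]
    ring
  rw [hpt]
  have i1 : Integrable (fun U : GaugeConfig 4 L (Matrix.specialUnitaryGroup (Fin N) ℂ) =>
      F U * conj (F (GaugeConfig.timeReflect U)) * linkKer β U)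
      (Measure.pi fun _ : Edge 4 L => haarProbability (Matrix.specialUnitaryGroup (Fin N) ℂ)) := iFF
  have i2 : Integrable (fun U : GaugeConfig 4 L (Matrix.specialUnitaryGroup (Fin N) ℂ) =>
      conj t * (F U * conj (G (GaugeConfig.timeReflect U)) * linkKer β U))
      (Measure.pi fun _ : Edge 4 L => haarProbability (Matrix.specialUnitaryGroup (Fin N) ℂ)) :=
    iGF.const_mul _
  have i3 : Integrable (fun U : GaugeConfig 4 L (Matrix.specialUnitaryGroup (Fin N) ℂ) =>
      t * (G U * conj (F (GaugeConfig.timeReflect U)) * linkKer β U))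
      (Measure.pi fun _ : Edge 4 L => haarProbability (Matrix.specialUnitaryGroup (Fin N) ℂ)) :=
    iFG.const_mul _
  have i4 : Integrable (fun U : GaugeConfig 4 L (Matrix.specialUnitaryGroup (Fin N) ℂ) =>
      conj t * t * (G U * conj (G (GaugeConfig.timeReflect U)) * linkKer β U))
      (Measure.pi fun _ : Edge 4 L => haarProbability (Matrix.specialUnitaryGroup (Fin N) ℂ)) :=
    iGG.const_mul _
  have i12 : Integrable (fun U : GaugeConfig 4 L (Matrix.specialUnitaryGroup (Fin N) ℂ) =>
      F U * conj (F (GaugeConfig.timeReflect U)) * linkKer β U +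
        conj t * (F U * conj (G (GaugeConfig.timeReflect U)) * linkKer β U))
      (Measure.pi fun _ : Edge 4 L => haarProbability (Matrix.specialUnitaryGroup (Fin N) ℂ)) := i1.add i2
  have i123 : Integrable (fun U : GaugeConfig 4 L (Matrix.specialUnitaryGroup (Fin N) ℂ) =>
      F U * conj (F (GaugeConfig.timeReflect U)) * linkKer β U +
        conj t * (F U * conj (G (GaugeConfig.timeReflect U)) * linkKer β U) +
        t * (G U * conj (F (GaugeConfig.timeReflect U)) * linkKer β U))
      (Measure.pi fun _ : Edge 4 L => haarProbability (Matrix.specialUnitaryGroup (Fin N) ℂ)) := i12.add i3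
  rw [integral_add i123 i4, integral_add i12 i3, integral_add i1 i2, integral_const_mul, integral_const_mul,
    integral_const_mul]

/-- The admissible class is closed under `F + t • G`. -/
theorem linkAdm_add_smul {F G : GaugeConfig 4 L (Matrix.specialUnitaryGroup (Fin N) ℂ) → ℂ} (t : ℂ)
    (hF : Measurable F ∧ (∃ K : ℝ, ∀ U, ‖F U‖ ≤ K) ∧
      DependsOn F ((WilsonRP.posEdges : Finset (Edge 4 L)) : Set (Edge 4 L)))
    (hG : Measurable G ∧ (∃ K : ℝ, ∀ U, ‖G U‖ ≤ K) ∧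
      DependsOn G ((WilsonRP.posEdges : Finset (Edge 4 L)) : Set (Edge 4 L))) :
    Measurable (F + t • G) ∧ (∃ K : ℝ, ∀ U, ‖(F + t • G) U‖ ≤ K) ∧
      DependsOn (F + t • G) ((WilsonRP.posEdges : Finset (Edge 4 L)) : Set (Edge 4 L)) := by
  obtain ⟨hFm, ⟨KF, hKF⟩, hFd⟩ := hF
  obtain ⟨hGm, ⟨KG, hKG⟩, hGd⟩ := hG
  refine ⟨hFm.add (hGm.const_smul t), ⟨KF + ‖t‖ * KG, fun U => ?_⟩, fun U V hUV => ?_⟩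
  · simp only [Pi.add_apply, Pi.smul_apply, smul_eq_mul]
    calc ‖F U + t * G U‖ ≤ ‖F U‖ + ‖t * G U‖ := norm_add_le _ _
      _ ≤ KF + ‖t‖ * KG := by
          rw [norm_mul]
          exact add_le_add (hKF U) (mul_le_mul_of_nonneg_left (hKG U) (norm_nonneg _))
  · simp only [Pi.add_apply, Pi.smul_apply, hFd hUV, hGd hUV]

end Summit.QuantumFields.QCD.Theorems.UnquenchedChessboardBoundLine

end
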